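import Mathlib
import Summits.ValiantsHypothesis.ValiantsHypothesis.Theorems.NewtonUnitEquationsTwoProductsPlanarCellChargingBound
import HarnessLib

/-!
# Crux `TwoProducts` (stmt-ValiantsHypothesis-5906), planar cells for GENERAL tails: the charged cell bound with the
# FRONTIER-LOCAL coincidence count

Theory lane (val-lit-p3 g13, CLAIM-FIRST #10; dossier HOME/lmr/DOSSIER-p3g13-5906-PlanarCell.md, statement T1).  `planarCell_charged`
(p604378) bounds the visible points of one weight-order cell by `2((m+1) + (m+1)³(s+1)·D)` with `D = coinTuples A` = ALL multiply-represented
letter tuples of `∏_j (A_j ∪ {0})` — a global count that is not `2^{O(m)}·poly(t)` (supports inside a short arithmetic progression make almost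
every tuple coincide).  The charging map of that proof, however, only ever lands in tuples obtained from the chosen representation `rep l` of a
visible point `l` by changing AT MOST TWO slots.  This file records the sharper statement BY NAME: with
  `coinTuplesNear A rep S` := #{a ∈ ∏_j (A_j ∪ {0}) : Σ a multiply represented ∧ ∃ l ∈ S, a agrees with rep l off ≤ 2 slots},
every cell family satisfies, for some admissible `rep` (`Σ rep l = l`, `F(rep l) ≠ G(rep l)`),
  `#S ≤ 2·((m+1) + (m+1)³(s+1)·coinTuplesNear A rep S)`   (`planarCell_charged_frontier`, via `card_class_le_charged_near`).
So `PlanarCellBound` follows from a `2^{O(m)}·poly(t)` bound on the frontier-local count (dossier T2 `FrontierCoinBound`, OPEN); the m = 2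
staircase (p599847/p600147) has this count `≍ t` with `≍ √t` visible points.  The proofs are those of p604378 with the codomain of the charging
map restricted; nothing else changes.

Honest framing: no bound on `coinTuplesNear` is proved here; `PlanarCross`, `PlanarCellBound`, the engine and the crux `TwoProducts` are OPEN;
`VP ≠ VNP` is NOT proved.  No named facts. [folklore]
-/

noncomputable section

-- Sub = Summit single-conjunct layout: the duplicated namespace component is mandated by the tree.
set_option linter.dupNamespace false

open scoped BigOperators
open MvPolynomial
open Summit.ValiantsHypothesis.ValiantsHypothesis.Theorems.NewtonUnitEquations.TwoProducts.FormalLogLinearisation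

namespace Summit.ValiantsHypothesis.ValiantsHypothesis.Theorems.NewtonUnitEquations.TwoProducts.PlanarCell

variable {m : ℕ}

/-! ## The frontier-local coincidence count -/

/-- Number of letter tuples of `∏_j (A_j ∪ {0})` whose point is multiply represented AND which agree with the representation `rep l`
of some `l ∈ S` off at most two slots (the tuples the charging map can reach from the family `S`). [folklore] -/
noncomputable def coinTuplesNear (A : Fin m → Finset Expo) (rep : Expo → Fin m → Expo) (S : Finset Expo) : ℕ :=
  ((Fintype.piFinset (fun j => insert (0 : Expo) (A j))).filter fun a =>
    (∃ b ∈ Fintype.piFinset (fun j => insert (0 : Expo) (A j)), b ≠ a ∧ ∑ j, b j = ∑ j, a j) ∧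
      ∃ l ∈ S, ∃ j j' : Fin m, ∀ i, i ≠ j → i ≠ j' → a i = rep l i).card

/-- The frontier-local count is at most the global one (`coinTuples`, p604378). [folklore] -/
theorem coinTuplesNear_le_coinTuples (A : Fin m → Finset Expo) (rep : Expo → Fin m → Expo) (S : Finset Expo) :
    coinTuplesNear A rep S ≤ coinTuples A := by
  unfold coinTuplesNear coinTuples
  exact Finset.card_le_card (Finset.monotone_filter_right _ fun a _ h => h.1)

/-! ## One class: clean part ≤ m + 1, dirty part charged to ADJACENT multiply-represented tuples -/

/-- **Class bound, frontier-local count.**  In one cell, with representations `rep`, the points of the class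
`{F(rep l) ≠ 0, F ≠ G}` number at most `(m + 1) + (m+1)³·(s+1)·coinTuplesNear A rep S` when `#A_j ≤ s`: the charging map of
`card_class_le_charged` (p604378) lands in multiply-represented tuples that AGREE WITH `rep l` OFF AT MOST TWO SLOTS for some `l ∈ S`. [folklore] -/
theorem card_class_le_charged_near (u v : Fin m → MvPolynomial (Fin 2) ℂ) (A : Fin m → Finset Expo) (s : ℕ)
    (hA0 : ∀ j, (0 : Expo) ∉ A j) (hAs : ∀ j, (A j).card ≤ s)
    (huA : ∀ j, (u j).support ⊆ A j) (hvA : ∀ j, (v j).support ⊆ A j)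
    (R : Expo → Expo → Prop) (S : Finset Expo)
    (hS : ∀ l ∈ S, ∃ ξ : Fin 2 → ℝ, ValidWeight u v ξ ∧ IsStrictTop ξ (logSupport u v) l ∧
      ∀ e ∈ tailSupport u v, ∀ e' ∈ tailSupport u v, (R e e' ↔ wt ξ e ≤ wt ξ e'))
    (ζ : Fin 2 → ℝ) (hζval : ValidWeight u v ζ)
    (hRζ : ∀ e ∈ tailSupport u v, ∀ e' ∈ tailSupport u v, (R e e' ↔ wt ζ e ≤ wt ζ e'))
    (rep : Expo → Fin m → Expo) (hrepPF : ∀ l ∈ S, rep l ∈ Fintype.piFinset (fun j => insert 0 (A j)))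
    (hrepsum : ∀ l ∈ S, ∑ j, rep l j = l) :
    (S.filter fun l => ∏ j, hatCoeff (u j) (rep l j) ≠ 0 ∧
        ∏ j, hatCoeff (u j) (rep l j) ≠ ∏ j, hatCoeff (v j) (rep l j)).card ≤
      (m + 1) + (m + 1) ^ 3 * (s + 1) * coinTuplesNear A rep S := by
  classical
  set PF := Fintype.piFinset (fun j => insert (0 : Expo) (A j)) with hPF
  set T := tailSupport u v with hT
  set CF := S.filter fun l => ∏ j, hatCoeff (u j) (rep l j) ≠ 0 ∧
    ∏ j, hatCoeff (u j) (rep l j) ≠ ∏ j, hatCoeff (v j) (rep l j) with hCF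
  have hCFS : ∀ l ∈ CF, l ∈ S := fun l hl => by rw [hCF, Finset.mem_filter] at hl; exact hl.1
  have hCFF : ∀ l ∈ CF, ∏ j, hatCoeff (u j) (rep l j) ≠ 0 ∧
      ∏ j, hatCoeff (u j) (rep l j) ≠ ∏ j, hatCoeff (v j) (rep l j) := fun l hl => by
    rw [hCF, Finset.mem_filter] at hl; exact hl.2
  -- multiply represented tuples
  let Mult : (Fin m → Expo) → Prop := fun a => ∃ b ∈ PF, b ≠ a ∧ ∑ j, b j = ∑ j, a j
  -- tuples adjacent to the family: agree with some `rep l`, `l ∈ S`, off at most two slots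
  let Near : (Fin m → Expo) → Prop := fun a => ∃ l ∈ S, ∃ j j' : Fin m, ∀ i, i ≠ j → i ≠ j' → a i = rep l i
  -- dirty points: some upgrade at ≤ 2 positions by strictly heavier letters of `CF` is multiply represented
  let up1 : Expo → Fin m → Expo → (Fin m → Expo) := fun l j l₁ => Function.update (rep l) j (rep l₁ j)
  let up2 : Expo → Fin m → Fin m → Expo → Expo → (Fin m → Expo) := fun l j j' l₁ l₂ =>
    Function.update (Function.update (rep l) j (rep l₁ j)) j' (rep l₂ j')
  let Dirty : Expo → Prop := fun l => ∃ j j' : Fin m, ∃ l₁ ∈ CF, ∃ l₂ ∈ CF, j ≠ j' ∧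
    wt ζ (rep l j) < wt ζ (rep l₁ j) ∧ wt ζ (rep l j') < wt ζ (rep l₂ j') ∧
    (Mult (up1 l j l₁) ∨ Mult (up1 l j' l₂) ∨ Mult (up2 l j j' l₁ l₂))
  set CD := CF.filter fun l => Dirty l with hCD
  set CC := CF.filter fun l => ¬ Dirty l with hCC
  -- the clean part
  have hCCcard : CC.card ≤ m + 1 := by
    refine card_clean_class_le u v A hA0 huA hvA R S hS ζ hζval hRζ rep hrepPF hrepsum CC
      (fun l hl => hCFS l (Finset.mem_filter.1 hl).1) (fun l hl => hCFF l (Finset.mem_filter.1 hl).1) ?_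
    intro l hl l₁ hl₁ l₂ hl₂ j j' hjj hj hj' a' ha' b hb hsum
    have hlCF : l ∈ CF := (Finset.mem_filter.1 hl).1
    have hnd : ¬ Dirty l := (Finset.mem_filter.1 hl).2
    by_contra hne
    apply hnd
    refine ⟨j, j', l₁, (Finset.mem_filter.1 hl₁).1, l₂, (Finset.mem_filter.1 hl₂).1, hjj, hj, hj', ?_⟩
    rcases ha' with rfl | rfl | rfl
    · exact Or.inl ⟨b, hb, hne, hsum⟩
    · exact Or.inr (Or.inl ⟨b, hb, hne, hsum⟩)
    · exact Or.inr (Or.inr ⟨b, hb, hne, hsum⟩)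
  -- letterwise non-domination inside `S` (pure weights), specialised: two points of `CF` whose representations differ in at
  -- most one slot are equal
  choose! ξ hval htop hRξ using hS
  have hu0 : ∀ j, coeff 0 (u j) = 0 := fun j => notMem_support_iff.1 fun h => hA0 j (huA j h)
  have hv0 : ∀ j, coeff 0 (v j) = 0 := fun j => notMem_support_iff.1 fun h => hA0 j (hvA j h)
  have htopW : ∀ l ∈ S, IsStrictTop (ξ l) ↑(tailDiff u v).support l := fun l hl =>
    (stub_logLinearisation m u v hu0 hv0 (ξ l) (hval l hl) l).2 (htop l hl)
  have hsupp : ∀ l ∈ S, l ∈ (tailDiff u v).support := fun l hl => (htopW l hl).1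
  have hT_of : ∀ (i : Fin m) (e : Expo), hatCoeff (u i) e ≠ 0 → e = 0 ∨ e ∈ T := by
    intro i e hne
    by_cases he : e = 0
    · exact Or.inl he
    · right
      simp only [hatCoeff, he, if_false] at hne
      exact Finset.mem_union_left _ (Finset.mem_biUnion.2 ⟨i, Finset.mem_univ _, mem_support_iff.2 hne⟩)
  have hletter : ∀ l ∈ CF, ∀ i, rep l i = 0 ∨ rep l i ∈ T := fun l hl i =>
    hT_of i _ ((Finset.prod_ne_zero_iff.1 (hCFF l hl).1) i (Finset.mem_univ _))
  have hwt0 : ∀ (η : Fin 2 → ℝ), wt η 0 = 0 := fun η => by simp [wt]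
  have hval_neg : ∀ l ∈ S, ∀ e ∈ T, wt (ξ l) e < 0 := by
    intro l hl e he
    rcases Finset.mem_union.1 he with h | h
    · obtain ⟨j, -, hj⟩ := Finset.mem_biUnion.1 h; exact (hval l hl).1 j e hj
    · obtain ⟨j, -, hj⟩ := Finset.mem_biUnion.1 h; exact (hval l hl).2 j e hj
  have hζ_neg : ∀ e ∈ T, wt ζ e < 0 := by
    intro e he
    rcases Finset.mem_union.1 he with h | h
    · obtain ⟨j, -, hj⟩ := Finset.mem_biUnion.1 h; exact hζval.1 j e hj
    · obtain ⟨j, -, hj⟩ := Finset.mem_biUnion.1 h; exact hζval.2 j e hj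
  have transfer : ∀ l ∈ S, ∀ p q : Expo, (p = 0 ∨ p ∈ T) → (q = 0 ∨ q ∈ T) →
      wt ζ q ≤ wt ζ p → wt (ξ l) q ≤ wt (ξ l) p := by
    intro l hl p q hp hq hle
    rcases hp with rfl | hp
    · rcases hq with rfl | hq
      · exact le_rfl
      · rw [hwt0]; exact (hval_neg l hl q hq).le
    · rcases hq with rfl | hq
      · exfalso; rw [hwt0] at hle; linarith [hζ_neg p hp]
      · exact (hRξ l hl q hq p hp).1 ((hRζ q hq p hp).2 hle)
  have hwt_rep : ∀ (η : Fin 2 → ℝ), ∀ l ∈ S, wt η l = ∑ j, wt η (rep l j) := by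
    intro η l hl
    conv_lhs => rw [← hrepsum l hl]
    exact wt_sum η _ _
  -- two points of `CF` with letterwise comparable representations are equal
  have heq_of_le : ∀ l ∈ CF, ∀ l' ∈ CF, (∀ i, wt ζ (rep l i) ≤ wt ζ (rep l' i)) → l = l' := by
    intro l hl l' hl' hle
    by_contra hne
    have hge : wt (ξ l) l ≤ wt (ξ l) l' := by
      rw [hwt_rep (ξ l) l (hCFS l hl), hwt_rep (ξ l) l' (hCFS l' hl')]
      exact Finset.sum_le_sum fun i _ =>
        transfer l (hCFS l hl) (rep l' i) (rep l i) (hletter l' hl' i) (hletter l hl i) (hle i)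
    have := (htopW l (hCFS l hl)).2 l' (hsupp l' (hCFS l' hl')) (Ne.symm hne)
    exact absurd hge (not_le.2 this)
  have heq_of_one_slot : ∀ l ∈ CF, ∀ l' ∈ CF, ∀ j' : Fin m, (∀ i, i ≠ j' → rep l i = rep l' i) → l = l' := by
    intro l hl l' hl' j' hagree
    rcases le_total (wt ζ (rep l j')) (wt ζ (rep l' j')) with h | h
    · exact heq_of_le l hl l' hl' fun i => by
        by_cases hi : i = j'
        · subst hi; exact h
        · rw [hagree i hi]
    · exact (heq_of_le l' hl' l hl fun i => by
        by_cases hi : i = j'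
        · subst hi; exact h
        · rw [hagree i hi]).symm
  have hsplit : CF.card = CC.card + CD.card := by
    rw [hCC, hCD, add_comm]; exact (Finset.card_filter_add_card_filter_not _).symm
  -- degenerate case `m = 0`: at most one visible point
  rcases Nat.eq_zero_or_pos m with hm0 | hmpos
  · subst hm0
    have : CF.card ≤ 1 := Finset.card_le_one.2 fun l hl l' hl' => by
      have hr : rep l = rep l' := funext fun i => i.elim0
      rw [← hrepsum l (hCFS l hl), ← hrepsum l' (hCFS l' hl'), hr]
    omega
  haveI : Nonempty (Fin m) := ⟨⟨0, hmpos⟩⟩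
  -- the charging map: dirty point ↦ (multiply represented tuple, first upgraded slot, optional second slot)
  have hchoice : ∀ l ∈ CD, ∃ c : (Fin m → Expo) × Fin m × Option (Fin m),
      c.1 ∈ PF.filter (fun a => Mult a) ∧
      (∀ i, i ≠ c.2.1 → (∀ j', c.2.2 = some j' → i ≠ j') → c.1 i = rep l i) ∧
      (c.2.2 = none ∨ ∃ j', c.2.2 = some j' ∧ j' ≠ c.2.1) := by
    intro l hl
    rw [hCD, Finset.mem_filter] at hl
    obtain ⟨hlCF, j, j', l₁, hl₁, l₂, hl₂, hjj, -, -, hmult⟩ := hl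
    have hPF1 : ∀ (k : Fin m) (l₀ : Expo), l₀ ∈ CF → Function.update (rep l) k (rep l₀ k) ∈ PF := by
      intro k l₀ hl₀
      rw [hPF, Fintype.mem_piFinset]; intro i
      by_cases hi : i = k
      · subst hi; rw [Function.update_self]; exact Fintype.mem_piFinset.1 (hPF ▸ hrepPF l₀ (hCFS l₀ hl₀)) i
      · rw [Function.update_of_ne hi]; exact Fintype.mem_piFinset.1 (hPF ▸ hrepPF l (hCFS l hlCF)) i
    rcases hmult with h1 | h2 | h12
    · refine ⟨(up1 l j l₁, j, none), Finset.mem_filter.2 ⟨hPF1 j l₁ hl₁, h1⟩, fun i hi _ => ?_, Or.inl rfl⟩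
      simp only [up1]; rw [Function.update_of_ne hi]
    · refine ⟨(up1 l j' l₂, j', none), Finset.mem_filter.2 ⟨hPF1 j' l₂ hl₂, h2⟩, fun i hi _ => ?_, Or.inl rfl⟩
      simp only [up1]; rw [Function.update_of_ne hi]
    · refine ⟨(up2 l j j' l₁ l₂, j, some j'), Finset.mem_filter.2 ⟨?_, h12⟩, fun i hi hi' => ?_, Or.inr ⟨j', rfl, hjj.symm⟩⟩
      · rw [hPF, Fintype.mem_piFinset]; intro i
        simp only [up2]
        by_cases hi : i = j'
        · subst hi; rw [Function.update_self]; exact Fintype.mem_piFinset.1 (hPF ▸ hrepPF l₂ (hCFS l₂ hl₂)) i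
        · rw [Function.update_of_ne hi]; exact Fintype.mem_piFinset.1 (hPF ▸ hPF1 j l₁ hl₁) i
      · simp only [up2]
        rw [Function.update_of_ne (hi' j' rfl), Function.update_of_ne hi]
  choose! ch hchPF hchagree hchshape using hchoice
  -- fibres of the charging map, refined by the letter in the first upgraded slot, are singletons
  let key : Expo → ((Fin m → Expo) × Fin m × Option (Fin m)) × Expo := fun l => (ch l, rep l (ch l).2.1)
  have hkeyinj : Set.InjOn key ↑CD := by
    intro l hl l' hl' h
    have hlCF : l ∈ CF := (Finset.mem_filter.1 hl).1
    have hl'CF : l' ∈ CF := (Finset.mem_filter.1 hl').1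
    obtain ⟨hc, hr⟩ := Prod.mk.inj h
    -- the representations agree off the second slot
    rcases hchshape l hl with hnone | ⟨j', hsome, hj'⟩
    · -- single upgrade: representations agree everywhere except possibly the first slot, where the letters agree too
      apply heq_of_le l hlCF l' hl'CF
      intro i
      by_cases hi : i = (ch l).2.1
      · rw [hi, hr, hc]
      · have e1 := hchagree l hl i hi (fun j' hj' => by rw [hnone] at hj'; exact absurd hj' (by simp))
        have e2 := hchagree l' hl' i (hc ▸ hi) (fun j' hj' => by rw [← hc, hnone] at hj'; exact absurd hj' (by simp))
        rw [← hc] at e2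
        rw [← e1, e2]
    · apply heq_of_one_slot l hlCF l' hl'CF j'
      intro i hij'
      by_cases hi : i = (ch l).2.1
      · rw [hi, hr, hc]
      · have e1 := hchagree l hl i hi (fun k hk => by rw [hsome] at hk; cases hk; exact hij')
        have e2 := hchagree l' hl' i (hc ▸ hi) (fun k hk => by rw [← hc, hsome] at hk; cases hk; exact hij')
        rw [← hc] at e2
        rw [← e1, e2]
  -- image of the refined key
  have himage : CD.image key ⊆ ((PF.filter fun a => Mult a ∧ Near a) ×ˢ
      ((Finset.univ : Finset (Fin m)) ×ˢ (Finset.univ : Finset (Option (Fin m))))) ×ˢ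
      (Finset.univ.biUnion fun j => insert (0 : Expo) (A j)) := by
    intro x hx
    obtain ⟨l, hl, rfl⟩ := Finset.mem_image.1 hx
    have hlS : l ∈ S := hCFS l (Finset.mem_filter.1 hl).1
    have hPFM := Finset.mem_filter.1 (hchPF l hl)
    have hnear : Near (ch l).1 := by
      refine ⟨l, hlS, (ch l).2.1, ((ch l).2.2).getD (ch l).2.1, fun i hi hi' => hchagree l hl i hi ?_⟩
      intro k hk
      rw [hk] at hi'
      simpa using hi'
    refine Finset.mem_product.2 ⟨Finset.mem_product.2 ⟨Finset.mem_filter.2 ⟨hPFM.1, hPFM.2, hnear⟩,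
      Finset.mem_product.2 ⟨Finset.mem_univ _, Finset.mem_univ _⟩⟩, ?_⟩
    exact Finset.mem_biUnion.2 ⟨(ch l).2.1, Finset.mem_univ _, Fintype.mem_piFinset.1 (hPF ▸ hrepPF l hlS) _⟩
  have hCDcard : CD.card ≤ (m + 1) ^ 3 * (s + 1) * coinTuplesNear A rep S := by
    have h1 : CD.card = (CD.image key).card := (Finset.card_image_of_injOn hkeyinj).symm
    have hletters : (Finset.univ.biUnion fun j => insert (0 : Expo) (A j)).card ≤ m * (s + 1) := by
      calc (Finset.univ.biUnion fun j => insert (0 : Expo) (A j)).card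
          ≤ ∑ j : Fin m, (insert (0 : Expo) (A j)).card := Finset.card_biUnion_le
        _ ≤ ∑ _j : Fin m, (s + 1) := Finset.sum_le_sum fun j _ => by
            rw [Finset.card_insert_of_notMem (hA0 j)]; exact Nat.succ_le_succ (hAs j)
        _ = m * (s + 1) := by simp
    have hD : (PF.filter fun a => Mult a ∧ Near a).card = coinTuplesNear A rep S := rfl
    have hprod : (((PF.filter fun a => Mult a ∧ Near a) ×ˢ
        ((Finset.univ : Finset (Fin m)) ×ˢ (Finset.univ : Finset (Option (Fin m))))) ×ˢ
        (Finset.univ.biUnion fun j => insert (0 : Expo) (A j))).card =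
        coinTuplesNear A rep S * (m * (m + 1)) * (Finset.univ.biUnion fun j => insert (0 : Expo) (A j)).card := by
      rw [Finset.card_product, Finset.card_product, Finset.card_product, hD]
      simp [Fintype.card_option]
    have hmm : coinTuplesNear A rep S * (m * (m + 1)) * (m * (s + 1)) ≤ (m + 1) ^ 3 * (s + 1) * coinTuplesNear A rep S := by
      have : m * (m + 1) * m ≤ (m + 1) ^ 3 := by nlinarith
      calc coinTuplesNear A rep S * (m * (m + 1)) * (m * (s + 1)) = (m * (m + 1) * m) * (s + 1) * coinTuplesNear A rep S := by ring
        _ ≤ (m + 1) ^ 3 * (s + 1) * coinTuplesNear A rep S := by gcongr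
    calc CD.card = (CD.image key).card := h1
      _ ≤ _ := Finset.card_le_card himage
      _ = coinTuplesNear A rep S * (m * (m + 1)) * (Finset.univ.biUnion fun j => insert (0 : Expo) (A j)).card := hprod
      _ ≤ coinTuplesNear A rep S * (m * (m + 1)) * (m * (s + 1)) := Nat.mul_le_mul_left _ hletters
      _ ≤ (m + 1) ^ 3 * (s + 1) * coinTuplesNear A rep S := hmm
  omega

/-! ## The frontier-local charged cell bound -/

/-- **CHARGED CELL BOUND, FRONTIER-LOCAL (general tails).**  With `#A_j ≤ s`, every cell family admits admissible
representations `rep` (`rep l ∈ ∏(A_j ∪ {0})`, `Σ rep l = l`, `F(rep l) ≠ G(rep l)`) with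
`#S ≤ 2·((m+1) + (m+1)³(s+1)·coinTuplesNear A rep S)`: only multiply-represented tuples ADJACENT to the family (agreeing with some
`rep l` off ≤ 2 slots) are charged.  This is the reduction «`PlanarCellBound` ⇐ a `2^{O(m)}·poly(t)` bound on the frontier-local
coincidence count» by name (dossier HOME/lmr/DOSSIER-p3g13-5906-PlanarCell.md, T1/T2). [folklore] -/
theorem planarCell_charged_frontier (u v : Fin m → MvPolynomial (Fin 2) ℂ) (A : Fin m → Finset Expo) (s : ℕ)
    (hA0 : ∀ j, (0 : Expo) ∉ A j) (hAs : ∀ j, (A j).card ≤ s)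
    (huA : ∀ j, (u j).support ⊆ A j) (hvA : ∀ j, (v j).support ⊆ A j)
    (R : Expo → Expo → Prop) (S : Finset Expo)
    (hS : ∀ l ∈ S, ∃ ξ : Fin 2 → ℝ, ValidWeight u v ξ ∧ IsStrictTop ξ (logSupport u v) l ∧
      ∀ e ∈ tailSupport u v, ∀ e' ∈ tailSupport u v, (R e e' ↔ wt ξ e ≤ wt ξ e')) :
    ∃ rep : Expo → Fin m → Expo,
      (∀ l ∈ S, rep l ∈ Fintype.piFinset (fun j => insert (0 : Expo) (A j)) ∧ ∑ j, rep l j = l ∧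
        ∏ j, hatCoeff (u j) (rep l j) ≠ ∏ j, hatCoeff (v j) (rep l j)) ∧
      S.card ≤ 2 * ((m + 1) + (m + 1) ^ 3 * (s + 1) * coinTuplesNear A rep S) := by
  classical
  set PF := Fintype.piFinset (fun j => insert (0 : Expo) (A j)) with hPF
  have hu0 : ∀ j, coeff 0 (u j) = 0 := fun j => notMem_support_iff.1 fun h => hA0 j (huA j h)
  have hv0 : ∀ j, coeff 0 (v j) = 0 := fun j => notMem_support_iff.1 fun h => hA0 j (hvA j h)
  rcases S.eq_empty_or_nonempty with hS0 | ⟨l₀, hl₀⟩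
  · exact ⟨fun _ _ => 0, by simp [hS0], by simp [hS0]⟩
  obtain ⟨ζ, hζval, -, hRζ⟩ := hS l₀ hl₀
  -- representations with `F ≠ G`
  have hrep : ∀ l ∈ S, ∃ a ∈ PF, ∑ j, a j = l ∧
      ∏ j, hatCoeff (u j) (a j) ≠ ∏ j, hatCoeff (v j) (a j) := by
    intro l hl
    obtain ⟨ξ, hval, htop, -⟩ := hS l hl
    have hmem : l ∈ (tailDiff u v).support := ((stub_logLinearisation m u v hu0 hv0 ξ hval l).2 htop).1
    have hne : coeff l (tailDiff u v) ≠ 0 := mem_support_iff.1 hmem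
    have hW : tailDiff u v = ∏ j, (1 + u j) - ∏ j, (1 + v j) := rfl
    rw [hW, coeff_sub, coeff_prod_one_add_eq_fibreSum u A hA0 huA, coeff_prod_one_add_eq_fibreSum v A hA0 hvA,
      ← Finset.sum_sub_distrib] at hne
    obtain ⟨a, ha, hne'⟩ := Finset.exists_ne_zero_of_sum_ne_zero hne
    rw [Finset.mem_filter] at ha
    exact ⟨a, ha.1, ha.2, fun h => hne' (sub_eq_zero.2 h)⟩
  choose! rep hrepPF hrepsum hrepne using hrep
  refine ⟨rep, fun l hl => ⟨hrepPF l hl, hrepsum l hl, hrepne l hl⟩, ?_⟩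
  -- the two classes
  have hF := card_class_le_charged_near u v A s hA0 hAs huA hvA R S hS ζ hζval hRζ rep hrepPF hrepsum
  have hS' : ∀ l ∈ S, ∃ ξ : Fin 2 → ℝ, ValidWeight v u ξ ∧ IsStrictTop ξ (logSupport v u) l ∧
      ∀ e ∈ tailSupport v u, ∀ e' ∈ tailSupport v u, (R e e' ↔ wt ξ e ≤ wt ξ e') := by
    intro l hl
    obtain ⟨ξ, hval, htop, hR⟩ := hS l hl
    refine ⟨ξ, (validWeight_swap u v ξ).2 hval, by rw [logSupport_swap]; exact htop, ?_⟩
    rw [tailSupport_swap]; exact hR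
  have hRζ' : ∀ e ∈ tailSupport v u, ∀ e' ∈ tailSupport v u, (R e e' ↔ wt ζ e ≤ wt ζ e') := by
    rw [tailSupport_swap]; exact hRζ
  have hG := card_class_le_charged_near v u A s hA0 hAs hvA huA R S hS' ζ ((validWeight_swap u v ζ).2 hζval) hRζ'
    rep hrepPF hrepsum
  -- cover
  have hcover : S ⊆ (S.filter fun l => ∏ j, hatCoeff (u j) (rep l j) ≠ 0 ∧
        ∏ j, hatCoeff (u j) (rep l j) ≠ ∏ j, hatCoeff (v j) (rep l j)) ∪
      (S.filter fun l => ∏ j, hatCoeff (v j) (rep l j) ≠ 0 ∧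
        ∏ j, hatCoeff (v j) (rep l j) ≠ ∏ j, hatCoeff (u j) (rep l j)) := by
    intro l hl
    rw [Finset.mem_union, Finset.mem_filter, Finset.mem_filter]
    have hne := hrepne l hl
    by_cases hF0 : ∏ j, hatCoeff (u j) (rep l j) = 0
    · right
      refine ⟨hl, ?_, fun h => hne h.symm⟩
      intro hG0; exact hne (by rw [hF0, hG0])
    · exact Or.inl ⟨hl, hF0, hne⟩
  calc S.card ≤ _ := Finset.card_le_card hcover
    _ ≤ _ := Finset.card_union_le _ _
    _ ≤ ((m + 1) + (m + 1) ^ 3 * (s + 1) * coinTuplesNear A rep S) + ((m + 1) + (m + 1) ^ 3 * (s + 1) * coinTuplesNear A rep S) :=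
        Nat.add_le_add hF hG
    _ = 2 * ((m + 1) + (m + 1) ^ 3 * (s + 1) * coinTuplesNear A rep S) := by ring

end Summit.ValiantsHypothesis.ValiantsHypothesis.Theorems.NewtonUnitEquations.TwoProducts.PlanarCell

end
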